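import Literature.Topology.FourManifolds.CoupleSphereDiffeo

/-!
# Structure conjugacy of two one-level Morse data on an oriented compact 3-manifold with boundary

Topic `Literature/Topology/FourManifolds` (support of `stmt-SmoothPoincare4-15190`; the consumer
form (F-ζ) of the structure-conjugacy chain concluded in `CoupleSphereDiffeo.lean`).  Everything
here is **proved**.

* `BasinCouple.exists_small` — couples of basin settings with small collar parameter and small
  sphere radius: `sph < c < 1 - a'` on both sides for prescribed levels `c` above the minima;
* `Cobordism.IsMorseFunction.structure_conjugacy` — **two Morse functions `gA`, `gB` on
  `(W; ∅, ∂W)` with smooth gradient-like fields, unique minima of the same value, all other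
  critical points of index `1` and of one common value, matched by a bijection `σ`, on an
  oriented `W`: there are a couple `C` of basin settings and a diffeomorphism `G` of `∂W`
  extending to a diffeomorphism of `W` with `G (trace_A s) = trace_B (σ s)` for every saddle.**

## References

* J. Milnor, *Lectures on the h-cobordism theorem* (1965), Thm. 3.4, Def. 3.9, Thm. 4.1, proof
  of Thm. 3.12/3.13. [MilnorHCobordism1965]
* M. W. Hirsch, *Differential Topology* (1976), Ch. 4 §4; Ch. 8 §3. [HirschDT1976]
-/

open scoped Manifold ContDiff Topology
open Set Function Filter Metric Module

noncomputable section

namespace Literature.Topology.FourManifolds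

open Cobordism FourManifolds.Flow TracePolar

universe u

variable {n : ℕ} {W : Type u} [TopologicalSpace W] [T2Space W] [SecondCountableTopology W]
  [CompactSpace W] [ChartedSpace (EuclideanHalfSpace (n + 1)) W] [IsManifold (𝓡∂ (n + 1)) ∞ W]
  {gA gB : W → ℝ} {ξA ξB : Π x : W, TangentSpace (𝓡∂ (n + 1)) x}

/-- **Couples with small parameters**: for levels `cA`, `cB` strictly between the minima and `1`
there is a couple of basin settings with `sph < c < 1 - a'` on both sides and the prescribed minima. [cite: MilnorHCobordism1965, Def. 3.1, proof of Thm. 3.4 (PDF pp. 11–13)] -/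
theorem BasinCouple.exists_small (hgA : (Cobordism.ofBoundary n W).IsMorseFunction gA) (hgB : (Cobordism.ofBoundary n W).IsMorseFunction gB)
    (hξAs : ContMDiff (𝓡∂ (n + 1)) (𝓡∂ (n + 1)).tangent ∞ fun x => (⟨x, ξA x⟩ : TangentBundle (𝓡∂ (n + 1)) W))
    (hξBs : ContMDiff (𝓡∂ (n + 1)) (𝓡∂ (n + 1)).tangent ∞ fun x => (⟨x, ξB x⟩ : TangentBundle (𝓡∂ (n + 1)) W))
    (hξA : IsGradientLike (𝓡∂ (n + 1)) gA ξA) (hξB : IsGradientLike (𝓡∂ (n + 1)) gB ξB)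
    {pA : W} (hpA : criticalSetOfIndex (𝓡∂ (n + 1)) gA 0 = {pA})
    {pB : W} (hpB : criticalSetOfIndex (𝓡∂ (n + 1)) gB 0 = {pB})
    {cA cB : ℝ} (hcA : gA pA < cA) (hcA1 : cA < 1) (hcB : gB pB < cB) (hcB1 : cB < 1) :
    ∃ C : BasinCouple gA gB ξA ξB, C.A.p₀ = pA ∧ C.B.p₀ = pB ∧
      C.A.sph < cA ∧ cA < 1 - C.A.S.a' ∧ C.B.sph < cB ∧ cB < 1 - C.B.S.a' := by
  obtain ⟨A₀⟩ := BasinSetting.nonempty hgA hξAs hξA hpA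
  obtain ⟨B₀⟩ := BasinSetting.nonempty hgB hξBs hξB hpB
  have hpA' : A₀.p₀ = pA := by have h := A₀.p₀_mem_criticalSetOfIndex; rw [hpA] at h; exact h
  have hpB' : B₀.p₀ = pB := by have h := B₀.p₀_mem_criticalSetOfIndex; rw [hpB] at h; exact h
  -- the parameters
  set a : ℝ := min (min A₀.S.a' B₀.S.a') (min ((1 - cA) / 2) ((1 - cB) / 2)) with ha
  have ha0 : 0 < a := lt_min (lt_min A₀.a'_pos B₀.a'_pos) (lt_min (by linarith) (by linarith))
  have haA : a ≤ A₀.S.a' := (min_le_left _ _).trans (min_le_left _ _)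
  have haB : a ≤ B₀.S.a' := (min_le_left _ _).trans (min_le_right _ _)
  have ha1 : a ≤ (1 - cA) / 2 := (min_le_right _ _).trans (min_le_left _ _)
  have ha2 : a ≤ (1 - cB) / 2 := (min_le_right _ _).trans (min_le_right _ _)
  set dA : ℝ := min 1 ((cA - gA pA) / 2) with hdA
  set dB : ℝ := min 1 ((cB - gB pB) / 2) with hdB
  have hdA0 : 0 < dA := lt_min one_pos (by linarith)
  have hdB0 : 0 < dB := lt_min one_pos (by linarith)
  set r : ℝ := min (min A₀.r₀ B₀.r₀) (min dA dB) with hr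
  have hr0 : 0 < r := lt_min (lt_min A₀.r₀_pos B₀.r₀_pos) (lt_min hdA0 hdB0)
  have hrA : r ≤ A₀.r₀ := (min_le_left _ _).trans (min_le_left _ _)
  have hrB : r ≤ B₀.r₀ := (min_le_left _ _).trans (min_le_right _ _)
  have hrdA : r ≤ dA := (min_le_right _ _).trans (min_le_left _ _)
  have hrdB : r ≤ dB := (min_le_right _ _).trans (min_le_right _ _)
  have hr2A : r ^ 2 < cA - gA pA := by
    have h1 : dA ≤ 1 := min_le_left _ _
    have h2 : dA ≤ (cA - gA pA) / 2 := min_le_right _ _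
    have h3 : r ^ 2 ≤ dA * 1 := by rw [sq]; exact mul_le_mul hrdA (hrdA.trans h1) hr0.le hdA0.le
    linarith
  have hr2B : r ^ 2 < cB - gB pB := by
    have h1 : dB ≤ 1 := min_le_left _ _
    have h2 : dB ≤ (cB - gB pB) / 2 := min_le_right _ _
    have h3 : r ^ 2 ≤ dB * 1 := by rw [sq]; exact mul_le_mul hrdB (hrdB.trans h1) hr0.le hdB0.le
    linarith
  obtain ⟨A, hAa, hAr, hAp, -⟩ := A₀.exists_a'_eq_r₀_eq ha0 haA hr0 hrA
  obtain ⟨B, hBa, hBr, hBp, -⟩ := B₀.exists_a'_eq_r₀_eq ha0 haB hr0 hrB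
  refine ⟨⟨A, B, by rw [hAa, hBa], by rw [hAr, hBr]⟩, ?_, ?_, ?_, ?_, ?_, ?_⟩
  · show A.p₀ = pA; rw [hAp, hpA']
  · show B.p₀ = pB; rw [hBp, hpB']
  · show gA A.p₀ + A.r₀ ^ 2 < cA
    rw [hAp, hpA', hAr]; linarith
  · show cA < 1 - A.S.a'
    rw [hAa]; linarith
  · show gB B.p₀ + B.r₀ ^ 2 < cB
    rw [hBp, hpB', hBr]; linarith
  · show cB < 1 - B.S.a'
    rw [hBa]; linarith

/-- **Saddle data of a couple with a prescribed bijection** (the construction of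
`BasinCouple.SaddleData.nonempty`, recording `σ`). [cite: MilnorHCobordism1965, Def. 3.1 (2) (PDF p. 12)] -/
theorem BasinCouple.exists_saddleData_σ (C : BasinCouple gA gB ξA ξB) {cA : ℝ} (hcA : ∀ s : SaddlePt n gA, gA s.1 = cA)
    (hsphA : C.A.sph < cA) (hcolA : cA < 1 - C.A.S.a') {cB : ℝ} (hcB : ∀ s : SaddlePt n gB, gB s.1 = cB) (hsphB : C.B.sph < cB)
    (hcolB : cB < 1 - C.B.S.a') (σ : SaddlePt n gA ≃ SaddlePt n gB)
    (hidx : ∀ s, morseIndex (𝓡∂ (n + 1)) gB (σ s).1 = morseIndex (𝓡∂ (n + 1)) gA s.1)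
    (hlt : ∀ s : SaddlePt n gA, morseIndex (𝓡∂ (n + 1)) gA s.1 < n + 1) : ∃ Q : C.SaddleData, Q.σ = σ := by
  have heqA : ∀ p, IsMCriticalPt (𝓡∂ (n + 1)) gA p → ∀ᶠ x in 𝓝 p, ξA x = ξA x := fun _ _ => Eventually.of_forall fun _ => rfl
  have heqB : ∀ p, IsMCriticalPt (𝓡∂ (n + 1)) gB p → ∀ᶠ x in 𝓝 p, ξB x = ξB x := fun _ _ => Eventually.of_forall fun _ => rfl
  obtain ⟨QA₀⟩ := BasinPair.SaddleData.nonempty (BasinPair.diag C.A) heqA hcA hsphA hcolA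
  obtain ⟨QB₀⟩ := BasinPair.SaddleData.nonempty (BasinPair.diag C.B) heqB hcB hsphB hcolB
  set ε : ℝ := min QA₀.ε QB₀.ε with hε
  have hε0 : 0 < ε := lt_min QA₀.ε_pos QB₀.ε_pos
  refine ⟨⟨QA₀.shrink ε hε0 (min_le_left _ _), QB₀.shrink ε hε0 (min_le_right _ _), rfl, σ, fun s => ?_⟩, rfl⟩
  simp only [BasinPair.SaddleData.shrink_DA_k]
  rw [BasinCouple.k_eq_morseIndex C.A s (QA₀.DA s) (hlt s),
    BasinCouple.k_eq_morseIndex C.B (σ s) (QB₀.DA (σ s)) (by rw [hidx]; exact hlt s), hidx]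

/-- **Structure conjugacy of two one-level Morse data** on an oriented compact `3`-manifold with
boundary: for two Morse functions on `(W; ∅, ∂W)` with smooth gradient-like fields, unique minima
of the same value, all other critical points of index `1` and of one common value `c`, matched by a
bijection `σ`, there are a couple of basin settings and a diffeomorphism `G` of `∂W` which extends
to a diffeomorphism of `W` and maps the trace of each saddle `s` of the first datum onto the trace
of `σ s` of the second. [cite: MilnorHCobordism1965, Thm. 3.4, Def. 3.9, proof of Thm. 3.12/3.13] [cite: HirschDT1976, Ch. 4 §4; Ch. 8 §3, Thm. 3.1] -/
theorem Cobordism.IsMorseFunction.structure_conjugacy {W : Type u} [TopologicalSpace W] [T2Space W] [SecondCountableTopology W]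
    [CompactSpace W] [ChartedSpace (EuclideanHalfSpace (2 + 1)) W] [IsManifold (𝓡∂ (2 + 1)) ∞ W]
    [Nonempty (BoundaryManifold.boundaryData 2 W).carrier]
    {gA gB : W → ℝ} {ξA ξB : Π x : W, TangentSpace (𝓡∂ (2 + 1)) x}
    (hgA : (Cobordism.ofBoundary 2 W).IsMorseFunction gA) (hgB : (Cobordism.ofBoundary 2 W).IsMorseFunction gB)
    (hξAs : ContMDiff (𝓡∂ (2 + 1)) (𝓡∂ (2 + 1)).tangent ∞ fun x => (⟨x, ξA x⟩ : TangentBundle (𝓡∂ (2 + 1)) W))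
    (hξBs : ContMDiff (𝓡∂ (2 + 1)) (𝓡∂ (2 + 1)).tangent ∞ fun x => (⟨x, ξB x⟩ : TangentBundle (𝓡∂ (2 + 1)) W))
    (hξA : IsGradientLike (𝓡∂ (2 + 1)) gA ξA) (hξB : IsGradientLike (𝓡∂ (2 + 1)) gB ξB)
    {pA : W} (hpA : criticalSetOfIndex (𝓡∂ (2 + 1)) gA 0 = {pA})
    {pB : W} (hpB : criticalSetOfIndex (𝓡∂ (2 + 1)) gB 0 = {pB})
    {c : ℝ} (hcA : ∀ s : SaddlePt 2 gA, gA s.1 = c) (hcB : ∀ s : SaddlePt 2 gB, gB s.1 = c)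
    (hval : gB pB = gA pA) (hc0 : gA pA < c) (hc1 : c < 1)
    (hiA : ∀ s : SaddlePt 2 gA, morseIndex (𝓡∂ (2 + 1)) gA s.1 = 1) (hiB : ∀ s : SaddlePt 2 gB, morseIndex (𝓡∂ (2 + 1)) gB s.1 = 1)
    (σ : SaddlePt 2 gA ≃ SaddlePt 2 gB) (o : SmoothOrientation (𝓡∂ (2 + 1)) W) :
    ∃ (C : BasinCouple gA gB ξA ξB) (G : (𝓡∂ (2 + 1)).boundary W ≃ₘ⟮𝓡 2, 𝓡 2⟯ (𝓡∂ (2 + 1)).boundary W),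
      (BoundaryManifold.boundaryData 2 W).DiffeoExtends G ∧ ∀ s y, G y ∈ C.B.traceOf (σ s) ↔ y ∈ C.A.traceOf s := by
  have hcB0 : gB pB < c := by rw [hval]; exact hc0
  obtain ⟨C, hpA', hpB', hsA, hcolA, hsB, hcolB⟩ :=
    BasinCouple.exists_small hgA hgB hξAs hξBs hξA hξB hpA hpB hc0 hc1 hcB0 hc1
  have hidx : ∀ s, morseIndex (𝓡∂ (2 + 1)) gB (σ s).1 = morseIndex (𝓡∂ (2 + 1)) gA s.1 := fun s => by rw [hiA, hiB]
  have hlt : ∀ s : SaddlePt 2 gA, morseIndex (𝓡∂ (2 + 1)) gA s.1 < 2 + 1 := fun s => by rw [hiA]; norm_num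
  obtain ⟨Q₀, hσ⟩ := C.exists_saddleData_σ hcA hsA hcolA hcB hsB hcolB σ hidx hlt
  have hkA : ∀ s, (Q₀.QA.DA s).k = 1 := fun s => by rw [BasinCouple.k_eq_morseIndex C.A s (Q₀.QA.DA s) (hlt s), hiA]
  have hltB : ∀ s' : SaddlePt 2 gB, morseIndex (𝓡∂ (2 + 1)) gB s'.1 < 2 + 1 := fun s' => by rw [hiB]; norm_num
  have hkB : ∀ s', (Q₀.QB.DA s').k = 1 := fun s' => by rw [BasinCouple.k_eq_morseIndex C.B s' (Q₀.QB.DA s') (hltB s'), hiB]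
  have h₀ : gB C.B.p₀ = gA C.A.p₀ := by rw [hpA', hpB', hval]
  by_cases hne : Nonempty (SaddlePt 2 gA)
  · obtain ⟨s₀⟩ := hne
    have hc : Q₀.QB.c = Q₀.QA.c := by
      rw [← Q₀.QA.apply_eq_c s₀, ← Q₀.QB.apply_eq_c (Q₀.σ s₀), hcA, hcB]
    obtain ⟨G, hG, hGt⟩ := Q₀.diffeoExtends_of_orientation hkA hkB h₀ hc o
    refine ⟨C, G, hG, fun s y => ?_⟩
    rw [← hσ]; exact hGt s y
  · refine ⟨C, Diffeomorph.refl (𝓡 2) _ ∞, ⟨Diffeomorph.refl (𝓡∂ (2 + 1)) W ∞, ?_⟩, fun s => ?_⟩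
    · funext y; rfl
    · exact absurd ⟨s⟩ hne

end Literature.Topology.FourManifolds
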